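import Summits.ResolutionOfSingularities.ResolutionOfSingularities.Theorems.WeightedInvariantOrbitCentreHomogeneousKernel
import HarnessLib

/-!
# E2 centre, (G-0-U) `E2HomogeneousSpanBody`, part 3a: homogeneity of a CONTRACTION `A ∩ I` from twist-stability at the generic
# torus point — E1's kernel WITHOUT the primary hypothesis (Krull's intersection theorem instead of nilpotence)

[OURS · L1 W4.3 · DOOR `HypersurfaceCentreConstruction` stmt-ResolutionOfSingularities-19897 · E2 tier, centre piece (C-c), hand
(G-0-U) (registrar res-L1-w43-plan-1, SPEC (Δ11); route (U-a)); res-D-pv-031 (gen 11).  Pure commutative algebra; the pattern and §1 of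
res-type-047's `…OrbitCentreHomogeneousKernel` (E1, (L3)) reused; nothing here is a statement of the manuscript under adjudication
[Hironaka2017]; candidate-design support, AI-written, weaker than expert review.]

SETTING (as in `…OrbitCentreHomogeneousKernel`): `A` graded by `M` (unique sums) with coaction `ρ : A → A[M]` and inclusion
`ι₀ = singleZeroRingHom`; `P` a prime of `A`, `O = A_P`, `𝔓 = P · A[M]`, `B = A[M]_𝔓`, `ε_P, ρ_P : O → B` induced by `ι₀, ρ`.

* `mem_map_comap_of_mul_mem_of_ne_top` — SATURATION for ANY proper ideal `I` of the NOETHERIAN local ring `O` (E1 §2 asked `I ⊇ (P O)^N`):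
  `s ∉ P · A[M] ∧ s z ∈ (A ∩ I) · A[M] ⇒ z ∈ (A ∩ I) · A[M]` — in `(O ⧸ I)[M]` a non-zero `z̄` has a coefficient outside some power
  `𝔫ⁿ` (Krull), and modulo `𝔫ⁿ` E1's §1 (unit coefficient versus nilpotent non-units) applies.
* `isHomogeneous_comap_of_map_le_of_ne_top` — KERNEL: `ρ_P(I) · B ≤ ε_P(I) · B ⇒ A ∩ I` HOMOGENEOUS, for every proper `I ⊆ O`, `O`
  Noetherian.  Use ((U-a) of (G-0-U)): `I = J(A_𝔪, F)_m` at a HOMOGENEOUS prime `𝔪` is twist-stable by (c11)≤3 + `JUnitInvariant`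
  (res-L1-s36-pv-1's `E2Model.J_map_localization_homogeneousCore_eq`), but only `(U)`-primary, not `𝔪 A_𝔪`-primary.
-/

noncomputable section

set_option linter.dupNamespace false -- mandated namespace of this single-conjunct summit

namespace Summit.ResolutionOfSingularities.ResolutionOfSingularities.Cruxes.HypersurfaceCentreConstruction.LocalEngine

namespace E2Span

open AddMonoidAlgebra IsLocalRing
open Summit.ResolutionOfSingularities.ResolutionOfSingularities.Theorems.DatumToEmbedded.CentreHomogeneous
open Summit.ResolutionOfSingularities.ResolutionOfSingularities.Theorems.OrbitCentreHomogeneous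

/-! ## Saturation without the primary hypothesis -/

section Saturation

variable {M A : Type*} [AddCommGroup M] [CommRing A]
  (P : Ideal A) [P.IsPrime] (O : Type*) [CommRing O] [Algebra A O] [IsLocalization.AtPrime O P]
  (I : Ideal O)

/-- **Saturation (Noetherian local version).**  Let `O = A_P` be Noetherian, `I ⊊ O` any proper ideal and `𝔞 = A ∩ I`.  If
`s ∈ A[M]` has a coefficient outside `P` and `s · z ∈ 𝔞 · A[M]`, then `z ∈ 𝔞 · A[M]`. [folklore] -/
theorem mem_map_comap_of_mul_mem_of_ne_top [UniqueSums M] [IsNoetherianRing O] (hI : I ≠ ⊤)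
    {s z : A[M]} {m₀ : M} (hs : s.coeff m₀ ∉ P)
    (h : s * z ∈ (I.comap (algebraMap A O)).map (singleZeroRingHom : A →+* A[M])) :
    z ∈ (I.comap (algebraMap A O)).map (singleZeroRingHom : A →+* A[M]) := by
  classical
  haveI : IsLocalRing O := IsLocalization.AtPrime.isLocalRing O P
  have hImax : I ≤ maximalIdeal O := IsLocalRing.le_maximalIdeal hI
  -- Krull: the powers of the maximal ideal of `O ⧸ I` intersect in `0`
  haveI : Nontrivial (O ⧸ I) := Ideal.Quotient.nontrivial_iff.mpr hI
  haveI : IsLocalRing (O ⧸ I) := IsLocalRing.of_surjective' (Ideal.Quotient.mk I) Ideal.Quotient.mk_surjective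
  haveI : IsNoetherianRing (O ⧸ I) := Ideal.Quotient.isNoetherianRing I
  -- the reduction maps `A[M] → C[M] → (C ⧸ 𝔫ⁿ)[M]`
  let φ : A[M] →+* (O ⧸ I)[M] := (mapRingHom M (Ideal.Quotient.mk I)).comp (mapRingHom M (algebraMap A O))
  have hφ : ∀ y : A[M], φ y = 0 ↔
      y ∈ (I.comap (algebraMap A O)).map (singleZeroRingHom : A →+* A[M]) := by
    intro y
    rw [mem_map_singleZeroRingHom_comap_iff, AddMonoidAlgebra.ext_iff, Finsupp.ext_iff]
    refine forall_congr' fun m => ?_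
    simp only [φ, RingHom.coe_comp, Function.comp_apply, coeff_mapRingHom, coeff_zero,
      Finsupp.coe_zero, Pi.zero_apply, Ideal.Quotient.eq_zero_iff_mem]
  rw [← hφ]
  by_contra hz
  -- a non-zero coefficient of `φ z`, outside some power of the maximal ideal of `C`
  obtain ⟨m₁, hm₁⟩ : ∃ m₁, (φ z).coeff m₁ ≠ 0 := by
    by_contra hall
    push Not at hall
    exact hz (by ext m; simpa using hall m)
  set C := O ⧸ I with hC
  have hKrull := Ideal.iInf_pow_eq_bot_of_isLocalRing (maximalIdeal C) (IsLocalRing.maximalIdeal.isMaximal C).ne_top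
  obtain ⟨n, hn⟩ : ∃ n, (φ z).coeff m₁ ∉ maximalIdeal C ^ n := by
    by_contra hall
    push Not at hall
    exact hm₁ ((Submodule.mem_bot C).mp (hKrull ▸ (Ideal.mem_iInf.mpr hall)))
  -- reduce modulo `𝔫ⁿ`
  set 𝔫n : Ideal C := maximalIdeal C ^ n with h𝔫n
  have h𝔫n_ne : 𝔫n ≠ ⊤ := by
    intro htop
    exact hn (htop ▸ Submodule.mem_top)
  let ψ : C[M] →+* (C ⧸ 𝔫n)[M] := mapRingHom M (Ideal.Quotient.mk 𝔫n)
  let 𝔫' : Ideal (C ⧸ 𝔫n) := (maximalIdeal C).map (Ideal.Quotient.mk 𝔫n)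
  have hunit : ∀ c, c ∉ 𝔫' → IsUnit c := by
    intro c hc
    obtain ⟨o, rfl⟩ := Ideal.Quotient.mk_surjective c
    have ho : o ∉ maximalIdeal C := fun ho => hc (Ideal.mem_map_of_mem _ ho)
    exact (IsLocalRing.notMem_maximalIdeal.mp ho).map _
  have hnil : 𝔫' ^ n = ⊥ := by
    rw [← Ideal.map_pow, eq_bot_iff, ← Ideal.map_quotient_self 𝔫n]
  -- the coefficient of `s` at `m₀` stays outside `𝔫'`
  have hm₀ : (ψ (φ s)).coeff m₀ ∉ 𝔫' := by
    simp only [ψ, φ, RingHom.coe_comp, Function.comp_apply, coeff_mapRingHom]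
    intro hmem
    rw [Ideal.mem_map_iff_of_surjective _ Ideal.Quotient.mk_surjective] at hmem
    obtain ⟨o, ho, hoe⟩ := hmem
    rw [Ideal.Quotient.eq] at hoe
    have h1 : (𝔫n : Ideal C) ≤ maximalIdeal C := IsLocalRing.le_maximalIdeal h𝔫n_ne
    have hin : Ideal.Quotient.mk I (algebraMap A O (s.coeff m₀)) ∈ maximalIdeal C := by
      have h2 : Ideal.Quotient.mk I (algebraMap A O (s.coeff m₀)) =
          o - (o - Ideal.Quotient.mk I (algebraMap A O (s.coeff m₀))) := by ring
      rw [h2]; exact Ideal.sub_mem _ ho (h1 hoe)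
    -- but `s.coeff m₀ ∉ P` is a unit in `O`, hence in `C`
    have hu : IsUnit (Ideal.Quotient.mk I (algebraMap A O (s.coeff m₀))) :=
      ((IsLocalization.AtPrime.isUnit_to_map_iff O P _).mpr hs).map _
    exact (IsLocalRing.notMem_maximalIdeal.mpr hu) hin
  have hprod : ψ (φ s) * ψ (φ z) = 0 := by
    rw [← map_mul, ← map_mul, (hφ _).mpr h, map_zero]
  have hzero := eq_zero_of_mul_eq_zero_of_coeff_not_mem 𝔫' hunit hnil hm₀ hprod
  -- contradiction at the coefficient `m₁`
  have : (ψ (φ z)).coeff m₁ = 0 := by rw [hzero]; simp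
  simp only [ψ, coeff_mapRingHom, Ideal.Quotient.eq_zero_iff_mem] at this
  exact hn this

end Saturation

/-! ## The kernel without the primary hypothesis -/

section Kernel

variable {M A σ : Type*} [DecidableEq M] [AddCommGroup M] [CommRing A] [SetLike σ A]
  [AddSubgroupClass σ A] (𝒜 : M → σ) [GradedRing 𝒜]
  (ρ : A →+* A[M]) (hρ : ∀ (i : M) (a : A), a ∈ 𝒜 i → ρ a = single i a)
  (P : Ideal A) [P.IsPrime] (O : Type*) [CommRing O] [Algebra A O] [IsLocalization.AtPrime O P]
  (𝔓 : Ideal A[M]) [𝔓.IsPrime] (h𝔓 : 𝔓 = P.map (singleZeroRingHom : A →+* A[M]))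
  (B : Type*) [CommRing B] [Algebra A[M] B] [IsLocalization.AtPrime B 𝔓]
  (εP ρP : O →+* B) (hε : εP.comp (algebraMap A O) = (algebraMap A[M] B).comp singleZeroRingHom)
  (hρP : ρP.comp (algebraMap A O) = (algebraMap A[M] B).comp ρ)
include hρ h𝔓 hε hρP

/-- **Kernel (Noetherian local version).**  With `O = A_P` Noetherian and `B = A[M]_{P A[M]}`: if a PROPER ideal `I ⊆ O` satisfies
`ρ_P(I) · B ≤ ε_P(I) · B`, then its contraction `A ∩ I` is HOMOGENEOUS.  (E1's `isHomogeneous_comap_of_map_le` asked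
`I ⊇ (P O)^N`; here Krull's intersection theorem replaces nilpotence, see `mem_map_comap_of_mul_mem_of_ne_top`.) [folklore] -/
theorem isHomogeneous_comap_of_map_le_of_ne_top [UniqueSums M] [IsNoetherianRing O] (I : Ideal O) (hI : I ≠ ⊤)
    (hle : I.map ρP ≤ I.map εP) : (I.comap (algebraMap A O)).IsHomogeneous 𝒜 := by
  refine isHomogeneous_of_map_coaction_le 𝒜 ρ hρ fun z hz => ?_
  set 𝔞 := I.comap (algebraMap A O) with h𝔞
  have h𝔞I : 𝔞.map (algebraMap A O) = I := by
    rw [h𝔞, ← Ideal.under_def, IsLocalization.map_under P.primeCompl (S := O)]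
  have h1 : algebraMap A[M] B z ∈ (𝔞.map (singleZeroRingHom : A →+* A[M])).map (algebraMap A[M] B) := by
    have hz' : algebraMap A[M] B z ∈ (𝔞.map ρ).map (algebraMap A[M] B) := Ideal.mem_map_of_mem _ hz
    rw [Ideal.map_map, ← hρP, ← Ideal.map_map] at hz'
    rw [Ideal.map_map, ← hε, ← Ideal.map_map, h𝔞I]
    exact hle (Ideal.map_mono (h𝔞I ▸ le_rfl) hz')
  obtain ⟨s, hs, hsz⟩ := (IsLocalization.algebraMap_mem_map_algebraMap_iff 𝔓.primeCompl B _ z).mp h1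
  have hcoeff : ∃ m₀, s.coeff m₀ ∉ P := by
    by_contra hall
    push Not at hall
    exact hs (h𝔓 ▸ mem_map_of_coeff_mem hall)
  obtain ⟨m₀, hm₀⟩ := hcoeff
  exact mem_map_comap_of_mul_mem_of_ne_top P O I hI hm₀ hsz

/-- The same with `I = ⊤` allowed (then `A ∩ I = A` is trivially homogeneous). [folklore] -/
theorem isHomogeneous_comap_of_map_le' [UniqueSums M] [IsNoetherianRing O] (I : Ideal O)
    (hle : I.map ρP ≤ I.map εP) : (I.comap (algebraMap A O)).IsHomogeneous 𝒜 := by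
  by_cases hI : I = ⊤
  · subst hI
    rw [Ideal.comap_top]
    exact Ideal.IsHomogeneous.top 𝒜
  · exact isHomogeneous_comap_of_map_le_of_ne_top 𝒜 ρ hρ P O 𝔓 h𝔓 B εP ρP hε hρP I hI hle

end Kernel

end E2Span

end Summit.ResolutionOfSingularities.ResolutionOfSingularities.Cruxes.HypersurfaceCentreConstruction.LocalEngine

end
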